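import Mathlib
import Summits.KontsevichZagierPeriods.KontsevichZagierPeriods.Theorems.InverseLandauTateFamilyKernelStubIsotopyThree
import Summits.KontsevichZagierPeriods.KontsevichZagierPeriods.Theorems.InverseLandauTateFamilyKernelStubFoldClass3

/-!
# Crux `TateFamilyKernel` (stmt-KontsevichZagierPeriods-9130), line `Sketch` — stub `stub_descentOfFold3`

CONSTRUCTOR: dimension-3 FOLD ELEMENTS inhabit the research stub's Tate descent normal form
(`stub_descentTate 1`) with ONE auxiliary cube variable (`m = 1`), two Ayoub elements (kind (a),
`K = 2`) and no symmetry / product terms (`L = J = 0`).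

Data (variables `X 0 = w₀`, `X 1 = w₁`, `X 2 = w₂`, `X 3 = ϖ` of `ℚ[w₀, w₁, w₂, ϖ]`): a polynomial
`c` vanishing on both faces `w₂ ∈ {0, 1}`, a rational `h = Bh/Eh ∈ ℚ(y₀, y₁, y₂, ϖ)` with
`Eh(w₀, w₁, s·c(w, ϖ₀), ϖ₀) ≠ 0` on `[0,1]³ × [0,1]`, and a Tate family `P/Q` whose fibre at `ϖ₀` on
the closed cube is the fold element `h(w₀, w₁, c(w, ϖ₀), ϖ₀) · (∂_{w₂} c)(w, ϖ₀)`.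

Proof. On the 4-cube `(w₀, w₁, w₂, s)` (variables `X 0, X 1, X 2, X 3`, parameter `ϖ = X 4` of
`ℚ[w₀, w₁, w₂, s, ϖ]`, re-indexing `ι = ![0, 1, 2, 4]`) take the straight-line isotopy
`Φ_s = (w₀, w₁, s·c̃)`, `c̃ = rename ι c`, of `stub_foldClass3`. Of the four Piola fluxes of
`stub_isotopyThree` only two survive (`φ₁ = w₀`, `φ₂ = w₁` have no `s`-dependence): the minors are
`M₀ = M₁ = 0`, `M₂ = ∂_s φ₃ = c̃`, `M₃ = J = s · (∂₂c)∼` (`Fold3.jacobian`). The transport identity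
`Iso3.transport` (with `Iso3.pderiv_bind₁_four`) therefore reads
`∂_{w₂}(BΦ·c̃ / EΦ) + ∂_s(−BΦ·J / EΦ) = 0` (`DescentOfFold3.transport_fold`), `BΦ = Bh∘Φ`,
`EΦ = Eh∘Φ`. The kind-(a) data are `A = ![BΦ·c̃, −BΦ·J]`, `Dn = ![EΦ, EΦ]`, directions `![2, 3]`:
the Griffiths parts cancel by transport, the `w₂`-faces of `BΦ·c̃` vanish with `c`, the `s = 0` face
of `BΦ·J` vanishes (`J = s·…`), and the `s = 1` face is `−h(w₀, w₁, c, ϖ₀)·∂₂c = −P/Q` (the fibre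
hypothesis); summing the two Ayoub elements gives `P/Q` pointwise on `[0,1]⁴`
(`DescentOfFold3.identity`). The empty kinds (d), (e) are indexed by `Fin 0`.
What is NOT here: the dimension-2 sisters (`stub_descentOfFold2`, `stub_descentOfJac2`) and the
research stub `stub_descentTate` itself.
References: Kontsevich–Zagier 2001 §1.2 rules (2), (3); Ayoub, EMS Newsl. 91 (2014) Def. 10.
-/

noncomputable section

open MeasureTheory Set MvPolynomial
open Literature.NumberTheory.Transcendental

namespace Summit.KontsevichZagierPeriods.InverseLandau.TateFamilyKernel.Descent

namespace DescentOfFold3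

variable {ι : Fin (3 + 1) → Fin (3 + 1 + 1)}

/-- A polynomial re-indexed along `ι = ![0, 1, 2, 4]` does not involve the isotopy parameter
`s = X 3`: `∂_s (rename ι p) = 0`. [folklore] -/
theorem pderiv_three_rename (hι : ι = ![0, 1, 2, 4]) (p : MvPolynomial (Fin (3 + 1)) ℚ) :
    pderiv 3 (rename ι p) = 0 := by
  classical
  have hne : ∀ k, ι k ≠ 3 := by
    subst hι
    decide
  refine pderiv_eq_zero_of_notMem_vars fun h => ?_
  obtain ⟨k, -, hk⟩ := Finset.mem_image.1 (vars_rename ι p h)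
  exact hne k hk

/-- **The transport identity of the fold isotopy**, cleared of denominators. For
`Φ_s = (w₀, w₁, s·c̃)` the Piola identity `Iso3.transport` has only two nonzero fluxes:
`∂_{w₂}(BΦ·c̃/EΦ) + ∂_s(−BΦ·(s·∂₂c̃)/EΦ) = 0`, i.e. the sum of the two quotient-rule numerators
vanishes (`M₀ = M₁ = 0`, `M₂ = c̃`, `M₃ = s·(∂₂ c)∼`). [folklore] -/
theorem transport_fold (hι : ι = ![0, 1, 2, 4]) (cf Bh Eh : MvPolynomial (Fin (3 + 1)) ℚ)
    {cR dcR BΦ EΦ : MvPolynomial (Fin (3 + 1 + 1)) ℚ} (hcR : cR = rename ι cf)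
    (hdcR : dcR = rename ι (pderiv 2 cf)) (hBΦ : BΦ = bind₁ ![X 0, X 1, X 3 * cR, X 4] Bh)
    (hEΦ : EΦ = bind₁ ![X 0, X 1, X 3 * cR, X 4] Eh) :
    pderiv 2 (BΦ * cR) * EΦ - BΦ * cR * pderiv 2 EΦ +
      (pderiv 3 (-(BΦ * (X 3 * dcR))) * EΦ - -(BΦ * (X 3 * dcR)) * pderiv 3 EΦ) = 0 := by
  subst hBΦ hEΦ
  have hd2 : pderiv 2 cR = dcR := by
    rw [hcR, hdcR]
    have h := pderiv_rename (Fold3.iota_injective hι) 2 cf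
    rwa [Fold3.iota_two hι] at h
  have hd3 : pderiv 3 cR = 0 := by
    rw [hcR]
    exact pderiv_three_rename hι cf
  have hd3' : pderiv 3 dcR = 0 := by
    rw [hdcR]
    exact pderiv_three_rename hι _
  have n02 : (0 : Fin (3 + 1 + 1)) ≠ 2 := by decide
  have n03 : (0 : Fin (3 + 1 + 1)) ≠ 3 := by decide
  have n12 : (1 : Fin (3 + 1 + 1)) ≠ 2 := by decide
  have n13 : (1 : Fin (3 + 1 + 1)) ≠ 3 := by decide
  have n32 : (3 : Fin (3 + 1 + 1)) ≠ 2 := by decide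
  have hjac : pderiv 0 (0 : MvPolynomial (Fin (3 + 1 + 1)) ℚ) -
      pderiv 1 (0 : MvPolynomial (Fin (3 + 1 + 1)) ℚ) + pderiv 2 cR - pderiv 3 (X 3 * dcR) = 0 := by
    rw [map_zero, map_zero, hd2, pderiv_mul, pderiv_X_self, hd3']
    ring
  have h₁ : pderiv 0 (X 0 : MvPolynomial (Fin (3 + 1 + 1)) ℚ) * 0 -
      pderiv 1 (X 0 : MvPolynomial (Fin (3 + 1 + 1)) ℚ) * 0 +
      pderiv 2 (X 0 : MvPolynomial (Fin (3 + 1 + 1)) ℚ) * cR -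
      pderiv 3 (X 0 : MvPolynomial (Fin (3 + 1 + 1)) ℚ) * (X 3 * dcR) = 0 := by
    rw [pderiv_X_of_ne n02, pderiv_X_of_ne n03]
    ring
  have h₂ : pderiv 0 (X 1 : MvPolynomial (Fin (3 + 1 + 1)) ℚ) * 0 -
      pderiv 1 (X 1 : MvPolynomial (Fin (3 + 1 + 1)) ℚ) * 0 +
      pderiv 2 (X 1 : MvPolynomial (Fin (3 + 1 + 1)) ℚ) * cR -
      pderiv 3 (X 1 : MvPolynomial (Fin (3 + 1 + 1)) ℚ) * (X 3 * dcR) = 0 := by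
    rw [pderiv_X_of_ne n12, pderiv_X_of_ne n13]
    ring
  have h₃ : pderiv 0 (X 3 * cR) * 0 - pderiv 1 (X 3 * cR) * 0 + pderiv 2 (X 3 * cR) * cR -
      pderiv 3 (X 3 * cR) * (X 3 * dcR) = 0 := by
    rw [mul_zero, mul_zero, pderiv_mul, pderiv_mul, hd2, hd3, pderiv_X_of_ne n32, pderiv_X_self]
    ring
  have key := Iso3.transport (φ₁ := X 0) (φ₂ := X 1) (φ₃ := X 3 * cR) (M₀ := 0) (M₁ := 0)
    (M₂ := cR) (M₃ := X 3 * dcR) (fun i hi => Iso3.pderiv_bind₁_four _ _ _ Bh hi)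
    (fun i hi => Iso3.pderiv_bind₁_four _ _ _ Eh hi) hjac h₁ h₂ h₃
  simpa only [mul_zero, zero_mul, neg_zero, map_zero, sub_zero, zero_add] using key

/-- The `w₂`-direction flux `BΦ·c̃` vanishes on the face `w₂ = 0` (`c = w₂·R` there). [folklore] -/
theorem aeval_wface_zero (hι : ι = ![0, 1, 2, 4]) {cf R : MvPolynomial (Fin (3 + 1)) ℚ}
    {cR : MvPolynomial (Fin (3 + 1 + 1)) ℚ} (hR : cf = X 2 * R) (hcR : cR = rename ι cf)
    (BΦ : MvPolynomial (Fin (3 + 1 + 1)) ℚ) (w : Fin (3 + 1) → ℝ) (ϖ₀ : ℝ) :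
    aeval (Fin.snoc (Function.update w 2 0) ϖ₀ : Fin (3 + 1 + 1) → ℝ) (BΦ * cR) = 0 := by
  have h2 : (Fin.snoc (Function.update w 2 0) ϖ₀ : Fin (3 + 1 + 1) → ℝ) 2 = 0 :=
    Iso3.snoc_update_apply w 2 0 ϖ₀
  rw [map_mul, hcR, aeval_rename, hR, map_mul, aeval_X, Function.comp_apply, Fold3.iota_two hι, h2,
    zero_mul, mul_zero]

/-- The `w₂`-direction flux `BΦ·c̃` vanishes on the face `w₂ = 1` (`c = (1 − w₂)·R` there).
[folklore] -/
theorem aeval_wface_one (hι : ι = ![0, 1, 2, 4]) {cf R : MvPolynomial (Fin (3 + 1)) ℚ}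
    {cR : MvPolynomial (Fin (3 + 1 + 1)) ℚ} (hR : cf = (1 - X 2) * R) (hcR : cR = rename ι cf)
    (BΦ : MvPolynomial (Fin (3 + 1 + 1)) ℚ) (w : Fin (3 + 1) → ℝ) (ϖ₀ : ℝ) :
    aeval (Fin.snoc (Function.update w 2 1) ϖ₀ : Fin (3 + 1 + 1) → ℝ) (BΦ * cR) = 0 := by
  have h2 : (Fin.snoc (Function.update w 2 1) ϖ₀ : Fin (3 + 1 + 1) → ℝ) 2 = 1 :=
    Iso3.snoc_update_apply w 2 1 ϖ₀
  rw [map_mul, hcR, aeval_rename, hR, map_mul, map_sub, map_one, aeval_X, Function.comp_apply,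
    Fold3.iota_two hι, h2, sub_self, zero_mul, mul_zero]

/-- The `s`-direction flux `−BΦ·J`, `J = s·(∂₂c)∼`, read at the double slice `(z, s, ϖ₀)`:
`−Bh(z₀, z₁, s·c(z, ϖ₀), ϖ₀) · (s · ∂₂c(z, ϖ₀))`. [folklore] -/
theorem aeval_sface (hι : ι = ![0, 1, 2, 4]) {cf Bh : MvPolynomial (Fin (3 + 1)) ℚ}
    {cR dcR BΦ : MvPolynomial (Fin (3 + 1 + 1)) ℚ} (hcR : cR = rename ι cf)
    (hdcR : dcR = rename ι (pderiv 2 cf)) (hBΦ : BΦ = bind₁ ![X 0, X 1, X 3 * cR, X 4] Bh)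
    (ϖ₀ : ℝ) (z : Fin 3 → ℝ) (s : ℝ) :
    aeval (Fin.snoc (Fin.snoc z s : Fin (3 + 1) → ℝ) ϖ₀ : Fin (3 + 1 + 1) → ℝ)
        (-(BΦ * (X 3 * dcR))) =
      -(aeval (Fin.snoc (![z 0, z 1, s * aeval (Fin.snoc z ϖ₀ : Fin (3 + 1) → ℝ) cf] : Fin 3 → ℝ)
            ϖ₀ : Fin (3 + 1) → ℝ) Bh *
          (s * aeval (Fin.snoc z ϖ₀ : Fin (3 + 1) → ℝ) (pderiv 2 cf))) := by
  rw [hBΦ, hcR, hdcR, map_neg, map_mul, Fold3.aeval_bind₁_isotopy hι,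
    Fold3.aeval_X_three_mul_rename hι]

/-- The common denominator `EΦ = Eh∘Φ_s` read at the double slice `(z, s, ϖ₀)`:
`Eh(z₀, z₁, s·c(z, ϖ₀), ϖ₀)`. [folklore] -/
theorem aeval_den (hι : ι = ![0, 1, 2, 4]) {cf Eh : MvPolynomial (Fin (3 + 1)) ℚ}
    {cR EΦ : MvPolynomial (Fin (3 + 1 + 1)) ℚ} (hcR : cR = rename ι cf)
    (hEΦ : EΦ = bind₁ ![X 0, X 1, X 3 * cR, X 4] Eh) (ϖ₀ : ℝ) (z : Fin 3 → ℝ) (s : ℝ) :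
    aeval (Fin.snoc (Fin.snoc z s : Fin (3 + 1) → ℝ) ϖ₀ : Fin (3 + 1 + 1) → ℝ) EΦ =
      aeval (Fin.snoc (![z 0, z 1, s * aeval (Fin.snoc z ϖ₀ : Fin (3 + 1) → ℝ) cf] : Fin 3 → ℝ)
        ϖ₀ : Fin (3 + 1) → ℝ) Eh := by
  rw [hEΦ, hcR, Fold3.aeval_bind₁_isotopy hι]

/-- **The denominator does not vanish on the closed 4-cube**: `Eh∘Φ_s(w, ϖ₀) ≠ 0` for
`(w, s) ∈ [0,1]³ × [0,1]` is the regularity hypothesis of `h` along `{(w₀, w₁, s·c)}`.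
[folklore] -/
theorem den_ne_zero (hι : ι = ![0, 1, 2, 4]) (cf Eh : MvPolynomial (Fin (3 + 1)) ℚ) (ϖ₀ : ℝ)
    (hEh : ∀ w ∈ KZ.cube 3, ∀ s ∈ Icc (0 : ℝ) 1,
      aeval (Fin.snoc (![w 0, w 1, s * aeval (Fin.snoc w ϖ₀ : Fin (3 + 1) → ℝ) cf] : Fin 3 → ℝ) ϖ₀ :
        Fin (3 + 1) → ℝ) Eh ≠ 0)
    {w : Fin (3 + 1) → ℝ} (hw : w ∈ KZ.cube (3 + 1)) :
    aeval (Fin.snoc w ϖ₀ : Fin (3 + 1 + 1) → ℝ) (bind₁ ![X 0, X 1, X 3 * rename ι cf, X 4] Eh) ≠ 0 := by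
  -- adapted from the third obligation of `stub_foldClass3`
  obtain ⟨z, s, rfl⟩ : ∃ (z : Fin 3 → ℝ) (s : ℝ), (Fin.snoc z s : Fin (3 + 1) → ℝ) = w :=
    ⟨Fin.init w, w (Fin.last 3), Fin.snoc_init_self w⟩
  obtain ⟨hz, hs0, hs1⟩ := KZ.snoc_mem_cube_iff.1 hw
  rw [Fold3.aeval_bind₁_isotopy hι]
  exact hEh z hz s ⟨hs0, hs1⟩

/-- **The pointwise certificate identity on `[0,1]⁴`.** With `A = ![BΦ·c̃, −BΦ·J]`, `Dn ≡ EΦ` and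
directions `![2, 3]` (`w₂` and `s`), the sum of the two Ayoub elements
`∂_{i_k}(A_k/EΦ) − (A_k/EΦ)|_{w_{i_k} = 1} + (A_k/EΦ)|_{w_{i_k} = 0}` at `(w, ϖ₀)` equals the fold
element `h(w₀, w₁, c, ϖ₀)·∂₂c = (P/Q)(w₀, w₁, w₂, ϖ₀)`: the derivative parts cancel
(`transport_fold`), the `w₂`-faces vanish (`aeval_wface_zero/one`), the `s = 0` face of `−BΦ·J/EΦ`
vanishes and its `s = 1` face is `−P/Q` (`aeval_sface`, `aeval_den`, the fibre hypothesis).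
[folklore] -/
theorem identity (hι : ι = ![0, 1, 2, 4]) {P Q cf Bh Eh R₀ R₁ : MvPolynomial (Fin (3 + 1)) ℚ}
    (hR₀ : cf = X 2 * R₀) (hR₁ : cf = (1 - X 2) * R₁) {ϖ₀ : ℝ}
    (hfib : ∀ w ∈ KZ.cube 3,
      aeval (Fin.snoc w ϖ₀ : Fin (3 + 1) → ℝ) P / aeval (Fin.snoc w ϖ₀ : Fin (3 + 1) → ℝ) Q =
        aeval (Fin.snoc (![w 0, w 1, aeval (Fin.snoc w ϖ₀ : Fin (3 + 1) → ℝ) cf] : Fin 3 → ℝ) ϖ₀ :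
            Fin (3 + 1) → ℝ) Bh /
          aeval (Fin.snoc (![w 0, w 1, aeval (Fin.snoc w ϖ₀ : Fin (3 + 1) → ℝ) cf] : Fin 3 → ℝ) ϖ₀ :
            Fin (3 + 1) → ℝ) Eh *
          aeval (Fin.snoc w ϖ₀ : Fin (3 + 1) → ℝ) (pderiv 2 cf))
    {cR dcR BΦ EΦ : MvPolynomial (Fin (3 + 1 + 1)) ℚ} (hcR : cR = rename ι cf)
    (hdcR : dcR = rename ι (pderiv 2 cf)) (hBΦ : BΦ = bind₁ ![X 0, X 1, X 3 * cR, X 4] Bh)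
    (hEΦ : EΦ = bind₁ ![X 0, X 1, X 3 * cR, X 4] Eh)
    {A Dn : Fin 2 → MvPolynomial (Fin (3 + 1 + 1)) ℚ} {i : Fin 2 → Fin (3 + 1)}
    (hA : A = ![BΦ * cR, -(BΦ * (X 3 * dcR))]) (hDn : Dn = fun _ => EΦ) (hi : i = ![2, 3])
    {w : Fin (3 + 1) → ℝ} (hw : w ∈ KZ.cube (3 + 1)) :
    aeval (Fin.snoc (fun t => w (Fin.castAdd 1 t)) ϖ₀ : Fin (3 + 1) → ℝ) P /
        aeval (Fin.snoc (fun t => w (Fin.castAdd 1 t)) ϖ₀ : Fin (3 + 1) → ℝ) Q =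
      ∑ k : Fin 2,
        (aeval (Fin.snoc w ϖ₀ : Fin (3 + 1 + 1) → ℝ)
            (pderiv (Fin.castSucc (i k)) (A k) * Dn k - A k * pderiv (Fin.castSucc (i k)) (Dn k)) /
          aeval (Fin.snoc w ϖ₀ : Fin (3 + 1 + 1) → ℝ) (Dn k ^ 2)
        - aeval (Fin.snoc (Function.update w (i k) 1) ϖ₀ : Fin (3 + 1 + 1) → ℝ) (A k) /
            aeval (Fin.snoc (Function.update w (i k) 1) ϖ₀ : Fin (3 + 1 + 1) → ℝ) (Dn k)
        + aeval (Fin.snoc (Function.update w (i k) 0) ϖ₀ : Fin (3 + 1 + 1) → ℝ) (A k) /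
            aeval (Fin.snoc (Function.update w (i k) 0) ϖ₀ : Fin (3 + 1 + 1) → ℝ) (Dn k)) := by
  subst hi hA hDn
  have hc2 : (Fin.castSucc (2 : Fin (3 + 1)) : Fin (3 + 1 + 1)) = 2 := rfl
  have hc3 : (Fin.castSucc (3 : Fin (3 + 1)) : Fin (3 + 1 + 1)) = 3 := rfl
  have hz : (fun j : Fin 3 => w (Fin.castAdd 1 j)) ∈ KZ.cube 3 :=
    KZ.mem_cube.2 fun j => KZ.mem_cube.1 hw _
  -- the derivative parts cancel by the transport identity
  have hsum : aeval (Fin.snoc w ϖ₀ : Fin (3 + 1 + 1) → ℝ)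
        (pderiv 2 (BΦ * cR) * EΦ - BΦ * cR * pderiv 2 EΦ) /
          aeval (Fin.snoc w ϖ₀ : Fin (3 + 1 + 1) → ℝ) (EΦ ^ 2) +
      aeval (Fin.snoc w ϖ₀ : Fin (3 + 1 + 1) → ℝ)
        (pderiv 3 (-(BΦ * (X 3 * dcR))) * EΦ - -(BΦ * (X 3 * dcR)) * pderiv 3 EΦ) /
          aeval (Fin.snoc w ϖ₀ : Fin (3 + 1 + 1) → ℝ) (EΦ ^ 2) = 0 := by
    rw [← add_div, ← map_add, transport_fold hι cf Bh Eh hcR hdcR hBΦ hEΦ, map_zero, zero_div]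
  simp only [Fin.sum_univ_two, Matrix.cons_val_zero, Matrix.cons_val_one, hc2, hc3]
  rw [aeval_wface_one hι hR₁ hcR BΦ w ϖ₀, aeval_wface_zero hι hR₀ hcR BΦ w ϖ₀, zero_div, zero_div,
    Iso3.snoc_update_three w 1 ϖ₀, Iso3.snoc_update_three w 0 ϖ₀, aeval_sface hι hcR hdcR hBΦ,
    aeval_sface hι hcR hdcR hBΦ, aeval_den hι hcR hEΦ, aeval_den hι hcR hEΦ, hfib _ hz]
  simp only [one_mul, zero_mul, mul_zero, neg_zero, zero_div, add_zero, sub_zero]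
  linear_combination -hsum

end DescentOfFold3

open DescentOfFold3 in
/-- STUB `stub_descentOfFold3` of line `Sketch` — **CONSTRUCTOR: dimension-3 fold transport
elements inhabit the research stub's normal form (`N = 1`, `m = 1`).** If the fibre `P/Q(·, ϖ₀)` on
the closed 3-cube is `h(w₀, w₁, c(w, ϖ₀), ϖ₀)·∂_{w₂}c(w, ϖ₀)` (`c = 0` on both `w₂`-faces,
`h = Bh/Eh` regular along `{(w₀, w₁, s·c)}`), then the `∃` of `stub_descentTate 1` holds at `ϖ₀`
with `m = 1`, `K = 2`, `L = J = 0`: on the 4-cube `(w₀, w₁, w₂, s)` the transport (Piola) identity of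
`stub_isotopyThree` for the fold isotopy `Φ_s = (w₀, w₁, s·c)` of `stub_foldClass3` has the two
surviving fluxes `BΦ·c̃` (direction `w₂`, vanishing on the `w₂`-faces) and `−BΦ·J`, `J = s·∂₂c̃`
(direction `s`, vanishing at `s = 0` and equal to `−P/Q` at `s = 1`), with common denominator
`Eh∘Φ_s ≠ 0` on the closed 4-cube; the kinds (d), (e) are empty.
[cite: KontsevichZagier2001, §1.2 rules (2), (3)] [cite: Ayoub2014, Def. 10] -/
theorem stub_descentOfFold3 (P Q : MvPolynomial (Fin (1 + 2 + 1)) ℚ)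
    (cf Bh Eh : MvPolynomial (Fin (3 + 1)) ℚ)
    (hc0 : ∃ R : MvPolynomial (Fin (3 + 1)) ℚ, cf = X 2 * R)
    (hc1 : ∃ R : MvPolynomial (Fin (3 + 1)) ℚ, cf = (1 - X 2) * R)
    (ϖ₀ : ℝ) (halg : IsAlgebraic ℚ ϖ₀)
    (hEh : ∀ w ∈ KZ.cube 3, ∀ s ∈ Icc (0 : ℝ) 1,
      aeval (Fin.snoc (![w 0, w 1, s * aeval (Fin.snoc w ϖ₀ : Fin (3 + 1) → ℝ) cf] : Fin 3 → ℝ) ϖ₀ :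
        Fin (3 + 1) → ℝ) Eh ≠ 0)
    (hfib : ∀ w ∈ KZ.cube 3,
      aeval (Fin.snoc w ϖ₀ : Fin (1 + 2 + 1) → ℝ) P / aeval (Fin.snoc w ϖ₀ : Fin (1 + 2 + 1) → ℝ) Q =
        aeval (Fin.snoc (![w 0, w 1, aeval (Fin.snoc w ϖ₀ : Fin (3 + 1) → ℝ) cf] : Fin 3 → ℝ) ϖ₀ :
            Fin (3 + 1) → ℝ) Bh /
          aeval (Fin.snoc (![w 0, w 1, aeval (Fin.snoc w ϖ₀ : Fin (3 + 1) → ℝ) cf] : Fin 3 → ℝ) ϖ₀ :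
            Fin (3 + 1) → ℝ) Eh *
          aeval (Fin.snoc w ϖ₀ : Fin (3 + 1) → ℝ) (pderiv 2 cf)) :
    ∃ (m K : ℕ) (A Dn : Fin K → MvPolynomial (Fin (1 + 2 + m + 1)) ℚ) (i : Fin K → Fin (1 + 2 + m))
        (L : ℕ) (B E : Fin L → MvPolynomial (Fin (1 + 2 + m + 1)) ℚ)
        (σ : Fin L → Equiv.Perm (Fin (1 + 2 + m))) (S : Fin L → Finset (Fin (1 + 2 + m)))
        (J : ℕ) (d c : Fin J → ℕ) (e : ∀ j, Fin (d j + c j) ≃ Fin (1 + 2 + m))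
        (Pj Qj : ∀ j, MvPolynomial (Fin (d j + 1)) ℚ) (bj : Fin J → ℝ)
        (Bj Ej : ∀ j, MvPolynomial (Fin (c j + 1)) ℚ),
        (∀ k, ∀ w ∈ KZ.cube (1 + 2 + m), aeval (Fin.snoc w ϖ₀ : Fin (1 + 2 + m + 1) → ℝ) (Dn k) ≠ 0) ∧
        (∀ l, ∀ w ∈ KZ.cube (1 + 2 + m), aeval (Fin.snoc w ϖ₀ : Fin (1 + 2 + m + 1) → ℝ) (E l) ≠ 0) ∧
        (∀ j, d j ≤ 1 + 1) ∧
        (∀ j, ∃ c₀ : ℚ, c₀ ≠ 0 ∧ ∀ y : Fin (d j) → ℝ,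
          aeval (Fin.snoc y (0 : ℝ) : Fin (d j + 1) → ℝ) (Qj j) = (c₀ : ℝ)) ∧
        (∀ j (y : Fin (d j) → ℝ) (ϖ : ℝ), (∀ t, y t ∈ Icc (0 : ℝ) 1) → ϖ ∈ Ioo 0 (bj j) →
          aeval (Fin.snoc y ϖ : Fin (d j + 1) → ℝ) (Qj j) ≠ 0) ∧
        (∀ j, ∀ ϖ ∈ Ioo 0 (bj j), ∫ y in Set.pi Set.univ (fun _ : Fin (d j) => Ioo (0 : ℝ) 1),
          aeval (Fin.snoc y ϖ : Fin (d j + 1) → ℝ) (Pj j) / aeval (Fin.snoc y ϖ : Fin (d j + 1) → ℝ) (Qj j) = 0) ∧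
        (∀ j, ϖ₀ ∈ Ioo 0 (bj j)) ∧
        (∀ j, ∀ y ∈ KZ.cube (c j), aeval (Fin.snoc y ϖ₀ : Fin (c j + 1) → ℝ) (Ej j) ≠ 0) ∧
        (∀ w ∈ KZ.cube (1 + 2 + m),
          aeval (Fin.snoc (fun t => w (Fin.castAdd m t)) ϖ₀ : Fin (1 + 2 + 1) → ℝ) P /
              aeval (Fin.snoc (fun t => w (Fin.castAdd m t)) ϖ₀ : Fin (1 + 2 + 1) → ℝ) Q =
            (∑ k : Fin K,
              (aeval (Fin.snoc w ϖ₀ : Fin (1 + 2 + m + 1) → ℝ)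
                  (pderiv (Fin.castSucc (i k)) (A k) * Dn k - A k * pderiv (Fin.castSucc (i k)) (Dn k)) /
                aeval (Fin.snoc w ϖ₀ : Fin (1 + 2 + m + 1) → ℝ) (Dn k ^ 2)
              - aeval (Fin.snoc (Function.update w (i k) 1) ϖ₀ : Fin (1 + 2 + m + 1) → ℝ) (A k) /
                  aeval (Fin.snoc (Function.update w (i k) 1) ϖ₀ : Fin (1 + 2 + m + 1) → ℝ) (Dn k)
              + aeval (Fin.snoc (Function.update w (i k) 0) ϖ₀ : Fin (1 + 2 + m + 1) → ℝ) (A k) /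
                  aeval (Fin.snoc (Function.update w (i k) 0) ϖ₀ : Fin (1 + 2 + m + 1) → ℝ) (Dn k))) +
            (∑ l : Fin L,
              (aeval (Fin.snoc w ϖ₀ : Fin (1 + 2 + m + 1) → ℝ) (B l) /
                  aeval (Fin.snoc w ϖ₀ : Fin (1 + 2 + m + 1) → ℝ) (E l) -
                aeval (Fin.snoc (fun t => if t ∈ S l then 1 - w (σ l t) else w (σ l t)) ϖ₀ :
                    Fin (1 + 2 + m + 1) → ℝ) (B l) /
                  aeval (Fin.snoc (fun t => if t ∈ S l then 1 - w (σ l t) else w (σ l t)) ϖ₀ :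
                    Fin (1 + 2 + m + 1) → ℝ) (E l))) +
            (∑ j : Fin J,
              aeval (Fin.snoc (fun t => w (e j (Fin.castAdd (c j) t))) ϖ₀ : Fin (d j + 1) → ℝ) (Pj j) /
                  aeval (Fin.snoc (fun t => w (e j (Fin.castAdd (c j) t))) ϖ₀ : Fin (d j + 1) → ℝ) (Qj j) *
                (aeval (Fin.snoc (fun t => w (e j (Fin.natAdd (d j) t))) ϖ₀ : Fin (c j + 1) → ℝ) (Bj j) /
                  aeval (Fin.snoc (fun t => w (e j (Fin.natAdd (d j) t))) ϖ₀ : Fin (c j + 1) → ℝ) (Ej j)))) := by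
  have _ := halg
  -- the re-indexing `ι : ℚ[w₀, w₁, w₂, ϖ] → ℚ[w₀, w₁, w₂, s, ϖ]`, kept opaque behind `hι`
  obtain ⟨ι, hι⟩ : ∃ ι : Fin (3 + 1) → Fin (3 + 1 + 1), ι = ![0, 1, 2, 4] := ⟨_, rfl⟩
  obtain ⟨R₀, hR₀⟩ := hc0
  obtain ⟨R₁, hR₁⟩ := hc1
  -- names for the certificate data (`X 0, X 1, X 2 = w`, `X 3 = s`, `X 4 = ϖ`)
  obtain ⟨cR, hcR⟩ : ∃ cR : MvPolynomial (Fin (3 + 1 + 1)) ℚ, cR = rename ι cf := ⟨_, rfl⟩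
  obtain ⟨dcR, hdcR⟩ : ∃ dcR : MvPolynomial (Fin (3 + 1 + 1)) ℚ, dcR = rename ι (pderiv 2 cf) :=
    ⟨_, rfl⟩
  obtain ⟨BΦ, hBΦ⟩ : ∃ BΦ : MvPolynomial (Fin (3 + 1 + 1)) ℚ,
    BΦ = bind₁ ![X 0, X 1, X 3 * cR, X 4] Bh := ⟨_, rfl⟩
  obtain ⟨EΦ, hEΦ⟩ : ∃ EΦ : MvPolynomial (Fin (3 + 1 + 1)) ℚ,
    EΦ = bind₁ ![X 0, X 1, X 3 * cR, X 4] Eh := ⟨_, rfl⟩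
  obtain ⟨A, hA⟩ : ∃ A : Fin 2 → MvPolynomial (Fin (3 + 1 + 1)) ℚ,
    A = ![BΦ * cR, -(BΦ * (X 3 * dcR))] := ⟨_, rfl⟩
  obtain ⟨Dn, hDn⟩ : ∃ Dn : Fin 2 → MvPolynomial (Fin (3 + 1 + 1)) ℚ, Dn = fun _ => EΦ := ⟨_, rfl⟩
  obtain ⟨i, hi⟩ : ∃ i : Fin 2 → Fin (3 + 1), i = ![2, 3] := ⟨_, rfl⟩
  -- the common denominator `Eh∘Φ_s` does not vanish on the closed 4-cube
  have hD : ∀ k, ∀ w ∈ KZ.cube (3 + 1), aeval (Fin.snoc w ϖ₀ : Fin (3 + 1 + 1) → ℝ) (Dn k) ≠ 0 := by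
    intro k w hw
    rw [hDn, hEΦ, hcR]
    exact den_ne_zero hι cf Eh ϖ₀ hEh hw
  refine ⟨1, 2, A, Dn, i, 0, Fin.elim0, Fin.elim0, Fin.elim0, Fin.elim0, 0, Fin.elim0, Fin.elim0,
    fun j => j.elim0, fun j => j.elim0, fun j => j.elim0, Fin.elim0, fun j => j.elim0,
    fun j => j.elim0, hD, fun l => l.elim0, fun j => j.elim0, fun j => j.elim0, fun j => j.elim0,
    fun j => j.elim0, fun j => j.elim0, fun j => j.elim0, fun w hw => ?_⟩
  -- kinds (d), (e) are empty; kind (a) is the pointwise certificate identity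
  simp only [Finset.univ_eq_empty, Finset.sum_empty, add_zero]
  exact identity hι hR₀ hR₁ hfib hcR hdcR hBΦ hEΦ hA hDn hi hw

end Summit.KontsevichZagierPeriods.InverseLandau.TateFamilyKernel.Descent
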